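import Literature.AnabelianGeometry.EtaleTheta.SettingModelChiZNStandardSplitting
import Literature.FieldTheory.KummerAbelianExponentContainment
import Literature.NumberTheory.GaloisRepresentations.AbsGaloisStronglyComplete
import Literature.NumberTheory.GaloisRepresentations.LocalFieldPadicProofs
import Mathlib.FieldTheory.Galois.Profinite
import HarnessLib

/-!
# The χ-model: the origin clause `GtpZNFromSplitting` HOLDS for ALL lifted splittings (Kummer containment + strong
# completeness of `G_{ℚ_p}`), proof-only

Mochizuki, *The étale theta function …*, Publ. RIMS **45** (2009) [EtTh], §1 p. 13–14 (kurims p. 13 l. 25–46): «any two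
splittings of `(Π^tp_{Y_N})^Θ/N·(Δ^tp_Y)^Θ ↠ G_{K_N}` differ by a cohomology class `∈ H¹(G_{K_N}, ℤ/Nℤ(1))`, it follows [by the
definition of `J_N`] that all splittings … determine the same splitting over `G_{J_N}` … whose kernel we denote by `Π^tp_{Z_N}`»
[cite: MochizukiEtTh2009, §1 p.14].  abc-iut cell, layer L2, seat abc-iut-w5-d062 (gen 4); PROOF-ONLY.

abc-iut-L2-t1's origin clause `ThetaSetting.GtpZNFromSplitting D N` (`ThetaSettingZNFromSplitting`, p446335) quantifies over
ALL lifted splittings `s` (no continuity); abc-iut-L2-d1 proved it at the χ-model `ThetaSetting.modelχ p` for the STANDARD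
splitting only (`gtpZN_iff_of_inr_splitting_modelχ`) and recorded FINDING F-L2d1g5-1 («TRUE in ZFC, NOT provable as typed
… needs ‹finite-index subgroups of `G_{K_N}` are open›»).  Both missing inputs are THEOREMS:

1. **the level character of a splitting.**  Any lifted splitting `s` over `G_{K_N}` has lifts `g_σ = inl(γ_σ)·inr(σ) ∈ Π^tp_{Y_N}`;
   `σ ↦ ĥ_N(γ_σ) ∈ {x = y = 0} ≅ ℤ/N` is a HOMOMORPHISM `f_s : G_{K_N} → ℤ/N` (`χ ≡ 1 mod N` on `G_{K_N}`, abc-iut-L2-t1's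
   `chiTwistData_δ_eq_self_of_mem_fieldKN`) — print's class in `H¹(G_{K_N}, ℤ/Nℤ(1))`;
2. **its kernel is open** — it has finite index in `G_{ℚ_p}`, which is STRONGLY COMPLETE (`isOpen_of_finiteIndex_absoluteGaloisGroup`,
   the tree's Nikolov–Segal-at-`G_k`, from topological finite generation of `G_{ℚ_p}` — hypothesis `hG`, unconditional
   Summits-side in `Summits/ABC/IUTFork/MLFGaloisTFG`);
3. **Kummer containment** (`Literature.FieldTheory.KummerContainment.apply_eq_one_of_mem_fixingSubgroup_adjoin_roots`,
   this seat): an exponent-`N` character of `G_{K_N}` with open kernel kills `G_{J_N}`, `J_N = K_N(K_N^{1/N})` (`fieldJN`),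
   because `K_N ⊇ μ_N`.
Hence `s` agrees with the standard splitting on `G_{J_N}` modulo `N·(Δ^tp_Y)^Θ`, and L2-d1's clause transfers:

* `right_eq_one_mul_inv_left` / bookkeeping in `Γ ⋊_χ G_{ℚ_p}`;
* `levelHom_left_mul_of_splitting` — (1); `levelHom_left_eq_one_of_mem_GJN_of_isOpen` — (3) given (2);
* **`gtpZNFromSplitting_modelχ_of_stronglyComplete`** — the clause for ALL splittings from strong completeness of `G_{ℚ_p}`;
* **`gtpZNFromSplitting_modelχ (hG : IsTopologicallyFinitelyGenerated G_{ℚ_p}) : ∀ N, (modelχ p).GtpZNFromSplitting N`**.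
F-L2d1g5-1 is thereby SUPERSEDED at the χ-model without the continuity repair (v-next DEFS item `IsThetaSplittingAtCont`
unnecessary for this clause).  SEMI-SYNTHETIC MODEL, consistency evidence only; nothing of [EtTh] asserted; no side taken on
[IUTchIII] Cor. 3.12; typed ≠ proved.
-/

noncomputable section

namespace Literature.AnabelianGeometry.EtaleTheta.SettingModel

open Literature.AnabelianGeometry.SemiGraphs Literature.AnabelianGeometry.AbsoluteAnabelian
open Literature.NumberTheory.GaloisRepresentations
open _root_.Function

variable (p : ℕ) [Fact p.Prime] (N : ℕ+)

/-! ### Bookkeeping in `Γ ⋊_χ G_{ℚ_p}` -/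

/-- In `Γ ⋊_φ G`: two elements with the same `G`-component differ by `inl` of the quotient of their `Γ`-components.
[cite: MochizukiEtTh2009, §1 p.12] -/
theorem mul_inv_eq_inl_of_right_eq {g h : PiTpχ p} (hr : g.right = h.right) :
    g * h⁻¹ = SemidirectProduct.inl (g.left * h.left⁻¹) := by
  refine SemidirectProduct.ext ?_ ?_
  · rw [SemidirectProduct.mul_left, SemidirectProduct.inv_left, SemidirectProduct.left_inl, ← MulAut.mul_apply,
      ← map_mul, hr, mul_inv_cancel, map_one, MulAut.one_apply]
  · rw [SemidirectProduct.mul_right, SemidirectProduct.inv_right, SemidirectProduct.right_inl, hr, mul_inv_cancel]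

/-- An element of `Π^tp_{Y_N}` has `Γ`-component in `Δ^tp_{Y_N} ⊆ Ker pr₂` and `G`-component in `G_{K_N}`.
[cite: MochizukiEtTh2009, §1 p.13] -/
theorem left_mem_dY_of_mem_YNχ {g : PiTpχ p} (hg : g ∈ YNχ p N) :
    g.left ∈ dY N ∧ g.left ∈ gfpSnd.ker ∧ g.right ∈ (fieldKN ⊥ (qModel p) N).fixingSubgroup := by
  obtain ⟨hl, hr⟩ := (GfpTwistData.mem_YN (chiTwistData p)).mp hg
  exact ⟨hl, dY_le N hl, hr⟩

/-- The level-`N` shadow of `Δ^tp_{Y_N}` lies on the `z`-axis `{x = y = 0}`. [cite: MochizukiEtTh2009, §1 p.13] -/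
theorem levelHom_mem_zAxis_of_mem_dY {γ : Gfp} (hγ : γ ∈ dY N) :
    (levelHom N γ).x = 0 ∧ (levelHom N γ).y = 0 :=
  Subgroup.mem_comap.mp (Subgroup.mem_inf.mp hγ).2

/-- The twist `χ(σ)` acts trivially on level-`N` shadows for `σ ∈ G_{K_N}` (`χ ≡ 1 mod N`).
[cite: MochizukiEtTh2009, §1 p.13] -/
theorem levelHom_actχ_of_mem_GKN {σ : GQp p} (hσ : σ ∈ (fieldKN ⊥ (qModel p) N).fixingSubgroup) (γ : Gfp) :
    levelHom N (actχ p σ γ) = levelHom N γ := by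
  rw [(chiTwistData p).hlev N σ γ, chiTwistData_δ_eq_self_of_mem_fieldKN p ⊥ (qModel p) N hσ]

/-! ### (1) The level character of a lifted splitting -/

section Splitting

variable {p N}
variable {g : ↥((ThetaSetting.modelχ p).GKN N) → PiTpχ p}

/-- **The level character is multiplicative.**  If `g_σ ∈ Π^tp_{Y_N}` lies over `σ` and the images `θ(g_σ)` form a splitting
modulo `N·(Δ^tp_Y)^Θ`, then `ĥ_N(γ_{στ}) = ĥ_N(γ_σ)·ĥ_N(γ_τ)` for the `Γ`-components `γ_σ = g_σ.left`.
[cite: MochizukiEtTh2009, §1 p.14] -/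
theorem levelHom_left_mul_of_splitting
    (hgY : ∀ σ, g σ ∈ YNχ p N) (hgr : ∀ σ, (g σ).right = (σ : GQp p))
    (hmul : ∀ σ τ, CurveTheta.toTheta (curveχ p) (g (σ * τ)) *
      (CurveTheta.toTheta (curveχ p) (g σ) * CurveTheta.toTheta (curveχ p) (g τ))⁻¹ ∈
        (ThetaSetting.modelχ p).thetaPowersY N)
    (σ τ : ↥((ThetaSetting.modelχ p).GKN N)) :
    levelHom N (g (σ * τ)).left = levelHom N (g σ).left * levelHom N (g τ).left := by
  have h := hmul σ τ
  rw [← map_mul, ← map_inv, ← map_mul] at h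
  -- `g(στ) · (g σ g τ)⁻¹ = inl(γ_{στ} · (γ_σ · χ(σ)γ_τ)⁻¹)`
  have hright : (g (σ * τ)).right = (g σ * g τ).right := by
    rw [SemidirectProduct.mul_right, hgr, hgr, hgr, Subgroup.coe_mul]
  rw [mul_inv_eq_inl_of_right_eq p hright] at h
  have hker₁ : (g (σ * τ)).left ∈ gfpSnd.ker := (left_mem_dY_of_mem_YNχ p N (hgY _)).2.1
  have hkerσ : (g σ).left ∈ gfpSnd.ker := (left_mem_dY_of_mem_YNχ p N (hgY _)).2.1
  have hkerτ : (g τ).left ∈ gfpSnd.ker := (left_mem_dY_of_mem_YNχ p N (hgY _)).2.1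
  have hker₂ : (g σ * g τ).left ∈ gfpSnd.ker := by
    rw [SemidirectProduct.mul_left]
    refine mul_mem hkerσ ?_
    rw [MonoidHom.mem_ker, (chiTwistData p).hdeg]
    exact hkerτ
  have hmem : (g (σ * τ)).left * (g σ * g τ).left⁻¹ ∈ gfpSnd.ker := mul_mem hker₁ (inv_mem hker₂)
  rw [toTheta_inl_mem_thetaPowersY_iff p N hmem, map_mul, map_inv, mul_inv_eq_one] at h
  rw [h, SemidirectProduct.mul_left, map_mul, hgr, levelHom_actχ_of_mem_GKN p N σ.2]

/-- The `z`-coordinates of the level shadows ADD (the shadows lie on the central `z`-axis): the map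
`σ ↦ ĥ_N(γ_σ).z` is a homomorphism `G_{K_N} → ℤ/N`. [cite: MochizukiEtTh2009, §1 p.14] -/
theorem levelHom_left_z_mul_of_splitting
    (hgY : ∀ σ, g σ ∈ YNχ p N) (hgr : ∀ σ, (g σ).right = (σ : GQp p))
    (hmul : ∀ σ τ, CurveTheta.toTheta (curveχ p) (g (σ * τ)) *
      (CurveTheta.toTheta (curveχ p) (g σ) * CurveTheta.toTheta (curveχ p) (g τ))⁻¹ ∈
        (ThetaSetting.modelχ p).thetaPowersY N)
    (σ τ : ↥((ThetaSetting.modelχ p).GKN N)) :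
    (levelHom N (g (σ * τ)).left).z = (levelHom N (g σ).left).z + (levelHom N (g τ).left).z := by
  rw [levelHom_left_mul_of_splitting hgY hgr hmul σ τ, Heis.mul_z,
    (levelHom_mem_zAxis_of_mem_dY N (left_mem_dY_of_mem_YNχ p N (hgY σ)).1).1, zero_mul, add_zero]

/-- A level shadow on the `z`-axis is trivial iff its `z`-coordinate vanishes. [cite: MochizukiEtTh2009, §1 p.14] -/
theorem levelHom_eq_one_iff_z_eq_zero {γ : Gfp} (hγ : γ ∈ dY N) :
    levelHom N γ = 1 ↔ (levelHom N γ).z = 0 := by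
  obtain ⟨hx, hy⟩ := levelHom_mem_zAxis_of_mem_dY N hγ
  constructor
  · intro h; rw [h, Heis.one_z]
  · intro hz; ext <;> simp [hx, hy, hz]

end Splitting

/-! ### (2) + (3): strong completeness of `G_{ℚ_p}` and Kummer containment -/

/-- **An exponent-`N` character of `G_{K_N}` with kernel of finite index kills `G_{J_N}`, granted strong completeness of
`G_{ℚ_p}`.**  For any homomorphism `f : G_{K_N} → ℤ/N` (written multiplicatively): its kernel has finite index in the open
`G_{K_N}`, hence in `G_{ℚ_p}`, hence is OPEN (`hsc`), and Kummer containment (`K_N ⊇ μ_N`,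
`KummerContainment.apply_eq_one_of_mem_fixingSubgroup_adjoin_roots`) gives `f = 1` on `G_{J_N} = Gal(ℚ̄_p/K_N(K_N^{1/N}))`.
[cite: MochizukiEtTh2009, §1 p.14] -/
theorem apply_eq_one_of_mem_GJN_of_stronglyComplete
    (hsc : ∀ U : Subgroup (GQp p), U.FiniteIndex → IsOpen (U : Set (GQp p)))
    (f : ↥((fieldKN ⊥ (qModel p) N).fixingSubgroup) →* Multiplicative (ZMod N))
    {σ : GQp p} (hσ : σ ∈ (fieldJN ⊥ (qModel p) N).fixingSubgroup) :
    ∃ h : σ ∈ (fieldKN ⊥ (qModel p) N).fixingSubgroup, f ⟨σ, h⟩ = 1 := by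
  haveI : IsGalois ℚ_[p] (PadicAlgCl p) := {}
  -- `K_N` contains all `N`-th roots of unity
  have hμ : ∀ ζ : PadicAlgCl p, ζ ^ (N : ℕ) = 1 → ζ ∈ fieldKN ⊥ (qModel p) N := fun ζ hζ =>
    IntermediateField.subset_adjoin _ _ (Or.inr (Or.inl hζ))
  -- `ℤ/N` is killed by `N`
  have hA : ∀ a : Multiplicative (ZMod (N : ℕ)), a ^ (N : ℕ) = 1 := fun a => by
    rw [← ofAdd_toAdd a, ← ofAdd_nsmul, nsmul_eq_mul, ZMod.natCast_self, zero_mul, ofAdd_zero]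
  -- the kernel is open: finite index in `G_{K_N}`, which has finite index in `G_{ℚ_p}` (open in a compact group)
  have hopen : IsOpen ((f.ker.map (fieldKN ⊥ (qModel p) N).fixingSubgroup.subtype : Subgroup (GQp p)) :
      Set (GQp p)) := by
    apply hsc
    haveI : Finite (↥(fieldKN ⊥ (qModel p) N).fixingSubgroup ⧸ f.ker) :=
      Finite.of_equiv _ (QuotientGroup.quotientKerEquivRange f).toEquiv.symm
    haveI : f.ker.FiniteIndex := Subgroup.finiteIndex_of_finite_quotient
    haveI : (fieldKN ⊥ (qModel p) N).fixingSubgroup.FiniteIndex := by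
      haveI : DiscreteTopology (GQp p ⧸ (fieldKN ⊥ (qModel p) N).fixingSubgroup) :=
        QuotientGroup.discreteTopology (isOpen_fixingSubgroup_fieldKN ⊥ (qModel p) N)
      haveI : Finite (GQp p ⧸ (fieldKN ⊥ (qModel p) N).fixingSubgroup) := finite_of_compact_of_discrete
      exact Subgroup.finiteIndex_of_finite_quotient
    refine ⟨?_⟩
    rw [Subgroup.index_map_subtype]
    exact mul_ne_zero Subgroup.FiniteIndex.index_ne_zero Subgroup.FiniteIndex.index_ne_zero
  exact Literature.FieldTheory.KummerContainment.apply_eq_one_of_mem_fixingSubgroup_adjoin_roots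
    (fieldKN ⊥ (qModel p) N) (N : ℕ) hμ hA f hopen hσ

/-- Strong completeness of `G_{ℚ_p}` from topological finite generation (the tree's Nikolov–Segal-at-`G_k`,
`isOpen_of_finiteIndex_absoluteGaloisGroup`). [cite: NikolovSegal2003, Thm 1.1] -/
theorem stronglyComplete_GQp_of_tfg (hG : IsTopologicallyFinitelyGenerated (Field.absoluteGaloisGroup ℚ_[p])) :
    ∀ U : Subgroup (GQp p), U.FiniteIndex → IsOpen (U : Set (GQp p)) := by
  intro U hU
  haveI : IsNonarchimedeanLocalField ℚ_[p] := Padic.isNonarchimedeanLocalField_holds p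
  exact @isOpen_of_finiteIndex_absoluteGaloisGroup ℚ_[p] _ _ _ _ _ hG U ⟨hU.index_ne_zero⟩

/-! ### The origin clause for `Z_N` at the χ-model, for ALL splittings -/

/-- **`GtpZNFromSplitting (modelχ p) N` for EVERY lifted splitting, granted strong completeness of `G_{ℚ_p}`.**  For a lifted
splitting `s` over `G_{K_N}` choose lifts `g_σ ∈ Π^tp_{Y_N}`; the level character `σ ↦ ĥ_N(γ_σ).z` (a homomorphism
`G_{K_N} → ℤ/N` by `levelHom_left_z_mul_of_splitting`) kills `G_{J_N}` (`apply_eq_one_of_mem_GJN_of_stronglyComplete`), so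
`s ≡ θ ∘ inr` on `G_{J_N}` modulo `N·(Δ^tp_Y)^Θ` and abc-iut-L2-d1's clause for the standard splitting
(`gtpZN_iff_of_inr_splitting_modelχ`, same level-coordinate computation) transfers. [cite: MochizukiEtTh2009, §1 p.14] -/
theorem gtpZNFromSplitting_modelχ_of_stronglyComplete
    (hsc : ∀ U : Subgroup (GQp p), U.FiniteIndex → IsOpen (U : Set (GQp p))) :
    (ThetaSetting.modelχ p).GtpZNFromSplitting N := by
  intro s hs g
  -- lifts of the splitting
  choose lift hliftY hliftaug hliftθ using hs.exists_lift
  have hliftr : ∀ σ, (lift σ).right = (σ : GQp p) := fun σ => hliftaug σ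
  have hmul : ∀ σ τ, CurveTheta.toTheta (curveχ p) (lift (σ * τ)) *
      (CurveTheta.toTheta (curveχ p) (lift σ) * CurveTheta.toTheta (curveχ p) (lift τ))⁻¹ ∈
        (ThetaSetting.modelχ p).thetaPowersY N := by
    intro σ τ
    have h := hs.map_mul_mem σ τ
    rw [← hliftθ, ← hliftθ, ← hliftθ] at h
    exact h
  -- the level character `f : G_{K_N} → ℤ/N`
  let f : ↥((fieldKN ⊥ (qModel p) N).fixingSubgroup) →* Multiplicative (ZMod N) :=
    MonoidHom.mk' (fun σ => Multiplicative.ofAdd (levelHom N (lift σ).left).z) fun σ τ => by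
      rw [← ofAdd_add]
      exact congrArg Multiplicative.ofAdd (levelHom_left_z_mul_of_splitting hliftY hliftr hmul σ τ)
  -- it kills `G_{J_N}`
  have hJ : ∀ (σ : GQp p) (hσ : σ ∈ (fieldJN ⊥ (qModel p) N).fixingSubgroup),
      levelHom N (lift ⟨σ, (ThetaSetting.modelχ p).GJN_le_GKN N hσ⟩).left = 1 := by
    intro σ hσ
    obtain ⟨h, h1⟩ := apply_eq_one_of_mem_GJN_of_stronglyComplete p N hsc f hσ
    have hz : (levelHom N (lift ⟨σ, (ThetaSetting.modelχ p).GJN_le_GKN N hσ⟩).left).z = 0 := ofAdd_eq_one.mp h1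
    exact (levelHom_eq_one_iff_z_eq_zero (left_mem_dY_of_mem_YNχ p N (hliftY _)).1).mpr hz
  -- the clause, as in the standard case, with `inl(γ_σ)·inr σ` for `inr σ`
  constructor
  · intro hZ
    obtain ⟨hl, hr⟩ := (GfpTwistData.mem_ZN (chiTwistData p)).mp hZ
    have hY : g ∈ (ThetaSetting.modelχ p).GtpYN N :=
      (GfpTwistData.mem_YN (chiTwistData p)).mpr ⟨dZ_le_dY N hl, (ThetaSetting.modelχ p).GJN_le_GKN N hr⟩
    refine ⟨hY, hr, ?_⟩
    set σ' : ↥((ThetaSetting.modelχ p).GKN N) := ⟨(ThetaSetting.modelχ p).aug g, (ThetaSetting.modelχ p).GJN_le_GKN N hr⟩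
    rw [← hliftθ σ']
    change CurveTheta.toTheta (curveχ p) g * (CurveTheta.toTheta (curveχ p) (lift σ'))⁻¹ ∈ _
    have hright : g.right = (lift σ').right := by rw [hliftr]; rfl
    have hJ' : levelHom N (lift σ').left = 1 := hJ _ hr
    rw [← map_inv, ← map_mul, mul_inv_eq_inl_of_right_eq p hright,
      toTheta_inl_mem_thetaPowersY_iff p N
        (mul_mem (Subgroup.mem_inf.mp hl).1 (inv_mem (left_mem_dY_of_mem_YNχ p N (hliftY σ')).2.1)),
      map_mul, map_inv, hJ', inv_one, mul_one]
    exact (Subgroup.mem_inf.mp hl).2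
  · rintro ⟨hY, hr, hmem⟩
    obtain ⟨hl, -⟩ := (GfpTwistData.mem_YN (chiTwistData p)).mp hY
    have hs' : g.left ∈ gfpSnd.ker := (Subgroup.mem_inf.mp hl).1
    set σ' : ↥((ThetaSetting.modelχ p).GKN N) := ⟨(ThetaSetting.modelχ p).aug g, (ThetaSetting.modelχ p).GJN_le_GKN N hr⟩
    rw [← hliftθ σ'] at hmem
    change CurveTheta.toTheta (curveχ p) g * (CurveTheta.toTheta (curveχ p) (lift σ'))⁻¹ ∈ _ at hmem
    have hright : g.right = (lift σ').right := by rw [hliftr]; rfl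
    have hJ' : levelHom N (lift σ').left = 1 := hJ _ hr
    rw [← map_inv, ← map_mul, mul_inv_eq_inl_of_right_eq p hright,
      toTheta_inl_mem_thetaPowersY_iff p N
        (mul_mem hs' (inv_mem (left_mem_dY_of_mem_YNχ p N (hliftY σ')).2.1)),
      map_mul, map_inv, hJ', inv_one, mul_one] at hmem
    exact (GfpTwistData.mem_ZN (chiTwistData p)).mpr ⟨Subgroup.mem_inf.mpr ⟨hs', hmem⟩, hr⟩

/-- **`GtpZNFromSplitting` HOLDS at the χ-model for ALL splittings and all levels `N`, granted the topological finite
generation of `G_{ℚ_p}`** (unconditional Summits-side: `Summits/ABC/IUTFork/MLFGaloisTFG`; Literature files cannot import it).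
F-L2d1g5-1 superseded without a continuity repair. [cite: MochizukiEtTh2009, §1 p.14] [cite: NikolovSegal2003, Thm 1.1] -/
theorem gtpZNFromSplitting_modelχ (hG : IsTopologicallyFinitelyGenerated (Field.absoluteGaloisGroup ℚ_[p])) (N : ℕ+) :
    (ThetaSetting.modelχ p).GtpZNFromSplitting N :=
  gtpZNFromSplitting_modelχ_of_stronglyComplete p N (stronglyComplete_GQp_of_tfg p hG)

/-- NV in the `∃`-over-settings shape used by the census: granted TFG of `G_{ℚ_p}`, SOME theta setting of [EtTh] origin
satisfies `GtpZNFromSplitting` at every level. [cite: MochizukiEtTh2009, §1 p.14] -/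
theorem exists_isEtThOrigin_gtpZNFromSplitting (hG : IsTopologicallyFinitelyGenerated (Field.absoluteGaloisGroup ℚ_[p])) :
    ∃ D : ThetaSetting p, D.IsEtThOrigin ∧ ∀ N, D.GtpZNFromSplitting N :=
  ⟨ThetaSetting.modelχ p, ThetaSetting.modelχ_isEtThOrigin p, gtpZNFromSplitting_modelχ p hG⟩

end Literature.AnabelianGeometry.EtaleTheta.SettingModel

end
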